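import Mathlib
import Summits.CriticalPhenomena.PercolationContinuityZ3.Theorems.PercNearOneGluingNoHeavyLowerTailOrientedAntipodalHallCoIntBipartiteAcyclic

/-!
# Conjecture O₅ for the three open tournaments reduces to the bare COUNT for full-type families

Helper file for crux `stmt-CriticalPhenomena-4575` (`NoHeavyLowerTail`, route `PercNearOneGluingNoHeavy`),
new-inequality factory seat `prim-ineq-gen-3` (gen 17).  Everything here is PROVED; no definitions.

Recall (memo `run/shared/lean/prim/prim-ineq-gen-3/PAPER-THREEFAMILY.md` §4–§6): for a monotone labelling
`f : Finset α → Lab k` an antipodal bad of type `(p, q)` is an `X ⊆ S` with `f X = petal p`, `f (S \ X) = petal q`; a good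
is a `U ⊆ S` with `f U = top`, `f (S \ U) = bot`.  Conjecture O_k says that every opposite-free family of bads has distinct
good representatives above its members.  After prim-hp-7's bipartite-acyclic theorem
(`exists_injective_good_above_of_oppositeFree_bipartiteAcyclic`, gen 54) the ONLY opposite-free type classes on five
petals that are not settled are the three ten-type tournaments `open1`, `open2`, `open3` below — and every PROPER subset
of their arc sets is bipartite-acyclic (checked here arc by arc, with explicit witnesses `(P, σ)`).

**Theorem (full-type reduction, `exists_injective_good_above_of_fullTypeCount`).**  Let `A` be an opposite-free set of
ordered petal pairs such that `A` minus any single arc is bipartite-acyclic.  If for every sub-family `D'` of `D` that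
realises ALL types of `A` the bare count `#D' ≤ #{goods above D'}` holds, then `D` has distinct good representatives.
Proof: Hall's marriage theorem; a sub-family missing some type `t` is a family of the bipartite-acyclic class `A - t`,
so prim-hp-7's theorem gives it an SDR and hence the count; full-type sub-families are covered by the hypothesis.

**Corollaries (`…_open1/2/3_of_fullTypeCount`).**  For each open tournament, Conjecture O₅ (Hall, all sub-families) is
equivalent to the COUNT `#D ≤ #{goods above D}` for families realising all ten types.  Consequences for the programme
(memo `FINDINGS-gen17.md`): certificates no longer need to be hereditary, and the adversarial target is the minimum
SURPLUS `#goods − #bads` over full-type families (large in every instance found so far).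
(prim-ineq-gen-3 gen 17, 2026-08-22.)
-/

namespace Summit.CriticalPhenomena.PercolationContinuityZ3.Theorems

namespace OrientedAntipodalHall

open Finset AntipodalStrongHarris AntipodalStrongHarris.Lab
open scoped FinsetFamily

variable {α : Type*} [DecidableEq α] {k : ℕ}

/-- From an SDR of goods to the count: if the members of `D` have distinct good representatives above them, then
`#D ≤ #{goods above D}`. -/
theorem card_le_card_goods_above_of_sdr (S : Finset α) (f : Finset α → Lab k) (D : Finset (Finset α))
    (φ : D → Finset α) (hinj : Function.Injective φ)
    (hφ : ∀ X : D, (X : Finset α) ⊆ φ X ∧ φ X ⊆ S ∧ f (φ X) = top ∧ f (S \ φ X) = bot) :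
    #D ≤ #{U ∈ S.powerset | f U = top ∧ f (S \ U) = bot ∧ ∃ X ∈ D, X ⊆ U} := by
  classical
  set G : Finset (Finset α) := {U ∈ S.powerset | f U = top ∧ f (S \ U) = bot ∧ ∃ X ∈ D, X ⊆ U} with hG
  have hmem : ∀ X : D, φ X ∈ G := by
    intro X
    obtain ⟨h1, h2, h3, h4⟩ := hφ X
    rw [hG, mem_filter, mem_powerset]
    exact ⟨h2, h3, h4, X, X.2, h1⟩
  let g : D → G := fun X => ⟨φ X, hmem X⟩
  have hg : Function.Injective g := by
    intro a b hab
    exact hinj (by simpa [g] using congrArg Subtype.val hab)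
  calc #D = Fintype.card D := (Fintype.card_coe D).symm
    _ ≤ Fintype.card G := Fintype.card_le_of_injective g hg
    _ = #G := Fintype.card_coe G

/-- **Full-type reduction.**  `A` an opposite-free set of ordered petal pairs such that for every arc `t ∈ A` the class
`A - t` is bipartite-acyclic (witnesses `P`, `σ` as in `exists_injective_good_above_of_oppositeFree_bipartiteAcyclic`).
If every sub-family of the `A`-bads `D` realising ALL types of `A` satisfies the count `#D' ≤ #{goods above D'}`, then
`D` has distinct good representatives (Hall). -/
theorem exists_injective_good_above_of_fullTypeCount (S : Finset α) {f : Finset α → Lab k}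
    (hf : ∀ ⦃X Y : Finset α⦄, X ⊆ Y → f X ≤ f Y) (D : Finset (Finset α)) (i j : Finset α → Fin k)
    (hDS : ∀ X ∈ D, X ⊆ S) (hDi : ∀ X ∈ D, f X = petal (i X)) (hDj : ∀ X ∈ D, f (S \ X) = petal (j X))
    (A : Finset (Fin k × Fin k)) (hT : ∀ X ∈ D, (i X, j X) ∈ A)
    (hOppA : ∀ a b : Fin k, (a, b) ∈ A → (b, a) ∉ A)
    (hBDA : ∀ t ∈ A, ∃ (P : Finset (Fin k)) (σ : Fin k → ℕ), ∀ a b : Fin k, (a, b) ∈ A → (a, b) ≠ t →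
      (a ∈ P ∧ b ∉ P) ∨ (a ∉ P ∧ b ∈ P) ∨ (a ∉ P ∧ b ∉ P ∧ σ a < σ b))
    (hcount : ∀ D' ⊆ D, (∀ t ∈ A, ∃ X ∈ D', (i X, j X) = t) →
      #D' ≤ #{U ∈ S.powerset | f U = top ∧ f (S \ U) = bot ∧ ∃ X ∈ D', X ⊆ U}) :
    ∃ φ : D → Finset α, Function.Injective φ ∧
      ∀ X : D, (X : Finset α) ⊆ φ X ∧ φ X ⊆ S ∧ f (φ X) = top ∧ f (S \ φ X) = bot := by
  classical
  let t : D → Finset (Finset α) := fun X =>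
    {U ∈ S.powerset | f U = top ∧ f (S \ U) = bot ∧ (X : Finset α) ⊆ U}
  have hHall : ∀ s : Finset D, #s ≤ #(s.biUnion t) := by
    intro s
    set D' : Finset (Finset α) := s.map (Function.Embedding.subtype _) with hD'
    have hD'sub : D' ⊆ D := by
      intro X hX
      obtain ⟨x, -, rfl⟩ := mem_map.mp hX
      exact x.2
    have hcard : #s = #D' := (card_map _).symm
    have hle : #D' ≤ #{U ∈ S.powerset | f U = top ∧ f (S \ U) = bot ∧ ∃ X ∈ D', X ⊆ U} := by
      by_cases hfull : ∀ t ∈ A, ∃ X ∈ D', (i X, j X) = t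
      · exact hcount D' hD'sub hfull
      · push Not at hfull
        obtain ⟨t₀, ht₀, hmiss⟩ := hfull
        obtain ⟨P, σ, hPσ⟩ := hBDA t₀ ht₀
        have hT' : ∀ X ∈ D', (i X ∈ P ∧ j X ∉ P) ∨ (i X ∉ P ∧ j X ∈ P) ∨
            (i X ∉ P ∧ j X ∉ P ∧ σ (i X) < σ (j X)) :=
          fun X hX => hPσ (i X) (j X) (hT X (hD'sub hX)) (hmiss X hX)
        have hOpp' : ∀ X ∈ D', ∀ X' ∈ D', ¬ (i X = j X' ∧ j X = i X') := by
          intro X hX X' hX' h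
          obtain ⟨h1, h2⟩ := h
          have hA := hT X' (hD'sub hX')
          rw [← h2, ← h1] at hA
          exact hOppA (i X) (j X) (hT X (hD'sub hX)) hA
        obtain ⟨φ, hφinj, hφ⟩ := exists_injective_good_above_of_oppositeFree_bipartiteAcyclic S hf D' i j
          (fun X hX => hDS X (hD'sub hX)) (fun X hX => hDi X (hD'sub hX)) (fun X hX => hDj X (hD'sub hX))
          P σ hT' hOpp'
        exact card_le_card_goods_above_of_sdr S f D' φ hφinj hφ
    have hgoods : {U ∈ S.powerset | f U = top ∧ f (S \ U) = bot ∧ ∃ X ∈ D', X ⊆ U} ⊆ s.biUnion t := by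
      intro U hU
      rw [mem_filter, mem_powerset] at hU
      obtain ⟨hUS, hUtop, hUbot, X, hX, hXU⟩ := hU
      obtain ⟨x, hx, rfl⟩ := mem_map.mp hX
      rw [mem_biUnion]
      refine ⟨x, hx, ?_⟩
      simp only [t, mem_filter, mem_powerset]
      exact ⟨hUS, hUtop, hUbot, hXU⟩
    calc #s = #D' := hcard
      _ ≤ #{U ∈ S.powerset | f U = top ∧ f (S \ U) = bot ∧ ∃ X ∈ D', X ⊆ U} := hle
      _ ≤ #(s.biUnion t) := card_le_card hgoods
  obtain ⟨φ, hφinj, hφ⟩ := (all_card_le_biUnion_card_iff_exists_injective t).mp hHall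
  refine ⟨φ, hφinj, fun X => ?_⟩
  have hX := hφ X
  simp only [t, mem_filter, mem_powerset] at hX
  exact ⟨hX.2.2.2, hX.1, hX.2.1, hX.2.2.1⟩

/-- Every proper subclass of the tournament `open1` = {01, 02, 03, 12, 14, 23, 24, 31, 34, 40} is bipartite-acyclic: for each arc `t` an explicit witness `(P, σ)` for the class without `t`. -/
theorem open1_minus_arc_bipartiteAcyclic :
    ∀ t ∈ ({((0 : Fin 5), (1 : Fin 5)), ((0 : Fin 5), (2 : Fin 5)), ((0 : Fin 5), (3 : Fin 5)), ((1 : Fin 5), (2 : Fin 5)), ((1 : Fin 5), (4 : Fin 5)), ((2 : Fin 5), (3 : Fin 5)), ((2 : Fin 5), (4 : Fin 5)), ((3 : Fin 5), (1 : Fin 5)), ((3 : Fin 5), (4 : Fin 5)), ((4 : Fin 5), (0 : Fin 5))} : Finset (Fin 5 × Fin 5)),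
      ∃ (P : Finset (Fin 5)) (σ : Fin 5 → ℕ), ∀ a b : Fin 5,
        (a, b) ∈ ({((0 : Fin 5), (1 : Fin 5)), ((0 : Fin 5), (2 : Fin 5)), ((0 : Fin 5), (3 : Fin 5)), ((1 : Fin 5), (2 : Fin 5)), ((1 : Fin 5), (4 : Fin 5)), ((2 : Fin 5), (3 : Fin 5)), ((2 : Fin 5), (4 : Fin 5)), ((3 : Fin 5), (1 : Fin 5)), ((3 : Fin 5), (4 : Fin 5)), ((4 : Fin 5), (0 : Fin 5))} : Finset (Fin 5 × Fin 5)) →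
        (a, b) ≠ t → (a ∈ P ∧ b ∉ P) ∨ (a ∉ P ∧ b ∈ P) ∨ (a ∉ P ∧ b ∉ P ∧ σ a < σ b) := by
  intro t ht
  simp only [mem_insert, mem_singleton] at ht
  rcases ht with rfl | rfl | rfl | rfl | rfl | rfl | rfl | rfl | rfl | rfl
  · exact ⟨({(0 : Fin 5), (1 : Fin 5)} : Finset (Fin 5)), (![0, 0, 1, 2, 3] : Fin 5 → ℕ), by decide⟩
  · exact ⟨({(0 : Fin 5), (2 : Fin 5)} : Finset (Fin 5)), (![0, 2, 0, 1, 3] : Fin 5 → ℕ), by decide⟩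
  · exact ⟨({(0 : Fin 5), (3 : Fin 5)} : Finset (Fin 5)), (![0, 1, 2, 0, 3] : Fin 5 → ℕ), by decide⟩
  · exact ⟨({(0 : Fin 5)} : Finset (Fin 5)), (![0, 3, 1, 2, 4] : Fin 5 → ℕ), by decide⟩
  · exact ⟨({(1 : Fin 5), (4 : Fin 5)} : Finset (Fin 5)), (![1, 0, 2, 3, 0] : Fin 5 → ℕ), by decide⟩
  · exact ⟨({(0 : Fin 5)} : Finset (Fin 5)), (![0, 2, 3, 1, 4] : Fin 5 → ℕ), by decide⟩
  · exact ⟨({(2 : Fin 5), (4 : Fin 5)} : Finset (Fin 5)), (![1, 3, 0, 2, 0] : Fin 5 → ℕ), by decide⟩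
  · exact ⟨({(0 : Fin 5)} : Finset (Fin 5)), (![0, 1, 2, 3, 4] : Fin 5 → ℕ), by decide⟩
  · exact ⟨({(3 : Fin 5), (4 : Fin 5)} : Finset (Fin 5)), (![1, 2, 3, 0, 0] : Fin 5 → ℕ), by decide⟩
  · exact ⟨({(1 : Fin 5)} : Finset (Fin 5)), (![1, 0, 2, 3, 4] : Fin 5 → ℕ), by decide⟩

/-- **Conjecture O₅ for `open1` (4→0, 0→{1,2,3}, {1,2,3}→4, triangle 1→2→3→1) reduces to the full-type count.**  If every sub-family of the `open1`-bads `D` realising all ten types has at most as many members as there are goods above it, then `D` has distinct good representatives. -/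
theorem exists_injective_good_above_open1_of_fullTypeCount (S : Finset α) {f : Finset α → Lab 5}
    (hf : ∀ ⦃X Y : Finset α⦄, X ⊆ Y → f X ≤ f Y) (D : Finset (Finset α)) (i j : Finset α → Fin 5)
    (hDS : ∀ X ∈ D, X ⊆ S) (hDi : ∀ X ∈ D, f X = petal (i X)) (hDj : ∀ X ∈ D, f (S \ X) = petal (j X))
    (hT : ∀ X ∈ D, (i X, j X) ∈ ({((0 : Fin 5), (1 : Fin 5)), ((0 : Fin 5), (2 : Fin 5)), ((0 : Fin 5), (3 : Fin 5)), ((1 : Fin 5), (2 : Fin 5)), ((1 : Fin 5), (4 : Fin 5)), ((2 : Fin 5), (3 : Fin 5)), ((2 : Fin 5), (4 : Fin 5)), ((3 : Fin 5), (1 : Fin 5)), ((3 : Fin 5), (4 : Fin 5)), ((4 : Fin 5), (0 : Fin 5))} : Finset (Fin 5 × Fin 5)))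
    (hcount : ∀ D' ⊆ D, (∀ t ∈ ({((0 : Fin 5), (1 : Fin 5)), ((0 : Fin 5), (2 : Fin 5)), ((0 : Fin 5), (3 : Fin 5)), ((1 : Fin 5), (2 : Fin 5)), ((1 : Fin 5), (4 : Fin 5)), ((2 : Fin 5), (3 : Fin 5)), ((2 : Fin 5), (4 : Fin 5)), ((3 : Fin 5), (1 : Fin 5)), ((3 : Fin 5), (4 : Fin 5)), ((4 : Fin 5), (0 : Fin 5))} : Finset (Fin 5 × Fin 5)), ∃ X ∈ D', (i X, j X) = t) →
      #D' ≤ #{U ∈ S.powerset | f U = top ∧ f (S \ U) = bot ∧ ∃ X ∈ D', X ⊆ U}) :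
    ∃ φ : D → Finset α, Function.Injective φ ∧
      ∀ X : D, (X : Finset α) ⊆ φ X ∧ φ X ⊆ S ∧ f (φ X) = top ∧ f (S \ φ X) = bot :=
  exists_injective_good_above_of_fullTypeCount S hf D i j hDS hDi hDj _ hT (by decide)
    open1_minus_arc_bipartiteAcyclic hcount

/-- Every proper subclass of the tournament `open2` = {01, 02, 03, 12, 14, 23, 24, 31, 40, 43} is bipartite-acyclic: for each arc `t` an explicit witness `(P, σ)` for the class without `t`. -/
theorem open2_minus_arc_bipartiteAcyclic :
    ∀ t ∈ ({((0 : Fin 5), (1 : Fin 5)), ((0 : Fin 5), (2 : Fin 5)), ((0 : Fin 5), (3 : Fin 5)), ((1 : Fin 5), (2 : Fin 5)), ((1 : Fin 5), (4 : Fin 5)), ((2 : Fin 5), (3 : Fin 5)), ((2 : Fin 5), (4 : Fin 5)), ((3 : Fin 5), (1 : Fin 5)), ((4 : Fin 5), (0 : Fin 5)), ((4 : Fin 5), (3 : Fin 5))} : Finset (Fin 5 × Fin 5)),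
      ∃ (P : Finset (Fin 5)) (σ : Fin 5 → ℕ), ∀ a b : Fin 5,
        (a, b) ∈ ({((0 : Fin 5), (1 : Fin 5)), ((0 : Fin 5), (2 : Fin 5)), ((0 : Fin 5), (3 : Fin 5)), ((1 : Fin 5), (2 : Fin 5)), ((1 : Fin 5), (4 : Fin 5)), ((2 : Fin 5), (3 : Fin 5)), ((2 : Fin 5), (4 : Fin 5)), ((3 : Fin 5), (1 : Fin 5)), ((4 : Fin 5), (0 : Fin 5)), ((4 : Fin 5), (3 : Fin 5))} : Finset (Fin 5 × Fin 5)) →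
        (a, b) ≠ t → (a ∈ P ∧ b ∉ P) ∨ (a ∉ P ∧ b ∈ P) ∨ (a ∉ P ∧ b ∉ P ∧ σ a < σ b) := by
  intro t ht
  simp only [mem_insert, mem_singleton] at ht
  rcases ht with rfl | rfl | rfl | rfl | rfl | rfl | rfl | rfl | rfl | rfl
  · exact ⟨({(0 : Fin 5), (1 : Fin 5)} : Finset (Fin 5)), (![0, 0, 1, 3, 2] : Fin 5 → ℕ), by decide⟩
  · exact ⟨({(1 : Fin 5)} : Finset (Fin 5)), (![3, 0, 1, 4, 2] : Fin 5 → ℕ), by decide⟩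
  · exact ⟨({(0 : Fin 5), (3 : Fin 5)} : Finset (Fin 5)), (![0, 1, 2, 0, 3] : Fin 5 → ℕ), by decide⟩
  · exact ⟨({(4 : Fin 5)} : Finset (Fin 5)), (![1, 4, 2, 3, 0] : Fin 5 → ℕ), by decide⟩
  · exact ⟨({(2 : Fin 5)} : Finset (Fin 5)), (![2, 4, 0, 3, 1] : Fin 5 → ℕ), by decide⟩
  · exact ⟨({(4 : Fin 5)} : Finset (Fin 5)), (![1, 3, 4, 2, 0] : Fin 5 → ℕ), by decide⟩
  · exact ⟨({(1 : Fin 5)} : Finset (Fin 5)), (![2, 0, 3, 4, 1] : Fin 5 → ℕ), by decide⟩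
  · exact ⟨({(0 : Fin 5)} : Finset (Fin 5)), (![0, 1, 2, 4, 3] : Fin 5 → ℕ), by decide⟩
  · exact ⟨({(1 : Fin 5)} : Finset (Fin 5)), (![1, 0, 2, 4, 3] : Fin 5 → ℕ), by decide⟩
  · exact ⟨({(3 : Fin 5), (4 : Fin 5)} : Finset (Fin 5)), (![1, 2, 3, 0, 0] : Fin 5 → ℕ), by decide⟩

/-- **Conjecture O₅ for `open2` (arcs 01, 02, 03, 12, 14, 23, 24, 31, 40, 43) reduces to the full-type count.**  If every sub-family of the `open2`-bads `D` realising all ten types has at most as many members as there are goods above it, then `D` has distinct good representatives. -/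
theorem exists_injective_good_above_open2_of_fullTypeCount (S : Finset α) {f : Finset α → Lab 5}
    (hf : ∀ ⦃X Y : Finset α⦄, X ⊆ Y → f X ≤ f Y) (D : Finset (Finset α)) (i j : Finset α → Fin 5)
    (hDS : ∀ X ∈ D, X ⊆ S) (hDi : ∀ X ∈ D, f X = petal (i X)) (hDj : ∀ X ∈ D, f (S \ X) = petal (j X))
    (hT : ∀ X ∈ D, (i X, j X) ∈ ({((0 : Fin 5), (1 : Fin 5)), ((0 : Fin 5), (2 : Fin 5)), ((0 : Fin 5), (3 : Fin 5)), ((1 : Fin 5), (2 : Fin 5)), ((1 : Fin 5), (4 : Fin 5)), ((2 : Fin 5), (3 : Fin 5)), ((2 : Fin 5), (4 : Fin 5)), ((3 : Fin 5), (1 : Fin 5)), ((4 : Fin 5), (0 : Fin 5)), ((4 : Fin 5), (3 : Fin 5))} : Finset (Fin 5 × Fin 5)))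
    (hcount : ∀ D' ⊆ D, (∀ t ∈ ({((0 : Fin 5), (1 : Fin 5)), ((0 : Fin 5), (2 : Fin 5)), ((0 : Fin 5), (3 : Fin 5)), ((1 : Fin 5), (2 : Fin 5)), ((1 : Fin 5), (4 : Fin 5)), ((2 : Fin 5), (3 : Fin 5)), ((2 : Fin 5), (4 : Fin 5)), ((3 : Fin 5), (1 : Fin 5)), ((4 : Fin 5), (0 : Fin 5)), ((4 : Fin 5), (3 : Fin 5))} : Finset (Fin 5 × Fin 5)), ∃ X ∈ D', (i X, j X) = t) →
      #D' ≤ #{U ∈ S.powerset | f U = top ∧ f (S \ U) = bot ∧ ∃ X ∈ D', X ⊆ U}) :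
    ∃ φ : D → Finset α, Function.Injective φ ∧
      ∀ X : D, (X : Finset α) ⊆ φ X ∧ φ X ⊆ S ∧ f (φ X) = top ∧ f (S \ φ X) = bot :=
  exists_injective_good_above_of_fullTypeCount S hf D i j hDS hDi hDj _ hT (by decide)
    open2_minus_arc_bipartiteAcyclic hcount

/-- Every proper subclass of the tournament `open3` = {01, 02, 12, 13, 23, 24, 30, 34, 40, 41} is bipartite-acyclic: for each arc `t` an explicit witness `(P, σ)` for the class without `t`. -/
theorem open3_minus_arc_bipartiteAcyclic :
    ∀ t ∈ ({((0 : Fin 5), (1 : Fin 5)), ((0 : Fin 5), (2 : Fin 5)), ((1 : Fin 5), (2 : Fin 5)), ((1 : Fin 5), (3 : Fin 5)), ((2 : Fin 5), (3 : Fin 5)), ((2 : Fin 5), (4 : Fin 5)), ((3 : Fin 5), (0 : Fin 5)), ((3 : Fin 5), (4 : Fin 5)), ((4 : Fin 5), (0 : Fin 5)), ((4 : Fin 5), (1 : Fin 5))} : Finset (Fin 5 × Fin 5)),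
      ∃ (P : Finset (Fin 5)) (σ : Fin 5 → ℕ), ∀ a b : Fin 5,
        (a, b) ∈ ({((0 : Fin 5), (1 : Fin 5)), ((0 : Fin 5), (2 : Fin 5)), ((1 : Fin 5), (2 : Fin 5)), ((1 : Fin 5), (3 : Fin 5)), ((2 : Fin 5), (3 : Fin 5)), ((2 : Fin 5), (4 : Fin 5)), ((3 : Fin 5), (0 : Fin 5)), ((3 : Fin 5), (4 : Fin 5)), ((4 : Fin 5), (0 : Fin 5)), ((4 : Fin 5), (1 : Fin 5))} : Finset (Fin 5 × Fin 5)) →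
        (a, b) ≠ t → (a ∈ P ∧ b ∉ P) ∨ (a ∉ P ∧ b ∈ P) ∨ (a ∉ P ∧ b ∉ P ∧ σ a < σ b) := by
  intro t ht
  simp only [mem_insert, mem_singleton] at ht
  rcases ht with rfl | rfl | rfl | rfl | rfl | rfl | rfl | rfl | rfl | rfl
  · exact ⟨({(0 : Fin 5), (1 : Fin 5)} : Finset (Fin 5)), (![0, 0, 1, 2, 3] : Fin 5 → ℕ), by decide⟩
  · exact ⟨({(1 : Fin 5)} : Finset (Fin 5)), (![4, 0, 1, 2, 3] : Fin 5 → ℕ), by decide⟩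
  · exact ⟨({(1 : Fin 5), (2 : Fin 5)} : Finset (Fin 5)), (![3, 0, 0, 1, 2] : Fin 5 → ℕ), by decide⟩
  · exact ⟨({(2 : Fin 5)} : Finset (Fin 5)), (![3, 4, 0, 1, 2] : Fin 5 → ℕ), by decide⟩
  · exact ⟨({(2 : Fin 5), (3 : Fin 5)} : Finset (Fin 5)), (![2, 3, 0, 0, 1] : Fin 5 → ℕ), by decide⟩
  · exact ⟨({(3 : Fin 5)} : Finset (Fin 5)), (![2, 3, 4, 0, 1] : Fin 5 → ℕ), by decide⟩
  · exact ⟨({(4 : Fin 5)} : Finset (Fin 5)), (![1, 2, 3, 4, 0] : Fin 5 → ℕ), by decide⟩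
  · exact ⟨({(3 : Fin 5), (4 : Fin 5)} : Finset (Fin 5)), (![1, 2, 3, 0, 0] : Fin 5 → ℕ), by decide⟩
  · exact ⟨({(0 : Fin 5), (4 : Fin 5)} : Finset (Fin 5)), (![0, 1, 2, 3, 0] : Fin 5 → ℕ), by decide⟩
  · exact ⟨({(0 : Fin 5)} : Finset (Fin 5)), (![0, 1, 2, 3, 4] : Fin 5 → ℕ), by decide⟩

/-- **Conjecture O₅ for `open3` (arcs 01, 02, 12, 13, 23, 24, 30, 34, 40, 41 (the regular tournament RT₅)) reduces to the full-type count.**  If every sub-family of the `open3`-bads `D` realising all ten types has at most as many members as there are goods above it, then `D` has distinct good representatives. -/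
theorem exists_injective_good_above_open3_of_fullTypeCount (S : Finset α) {f : Finset α → Lab 5}
    (hf : ∀ ⦃X Y : Finset α⦄, X ⊆ Y → f X ≤ f Y) (D : Finset (Finset α)) (i j : Finset α → Fin 5)
    (hDS : ∀ X ∈ D, X ⊆ S) (hDi : ∀ X ∈ D, f X = petal (i X)) (hDj : ∀ X ∈ D, f (S \ X) = petal (j X))
    (hT : ∀ X ∈ D, (i X, j X) ∈ ({((0 : Fin 5), (1 : Fin 5)), ((0 : Fin 5), (2 : Fin 5)), ((1 : Fin 5), (2 : Fin 5)), ((1 : Fin 5), (3 : Fin 5)), ((2 : Fin 5), (3 : Fin 5)), ((2 : Fin 5), (4 : Fin 5)), ((3 : Fin 5), (0 : Fin 5)), ((3 : Fin 5), (4 : Fin 5)), ((4 : Fin 5), (0 : Fin 5)), ((4 : Fin 5), (1 : Fin 5))} : Finset (Fin 5 × Fin 5)))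
    (hcount : ∀ D' ⊆ D, (∀ t ∈ ({((0 : Fin 5), (1 : Fin 5)), ((0 : Fin 5), (2 : Fin 5)), ((1 : Fin 5), (2 : Fin 5)), ((1 : Fin 5), (3 : Fin 5)), ((2 : Fin 5), (3 : Fin 5)), ((2 : Fin 5), (4 : Fin 5)), ((3 : Fin 5), (0 : Fin 5)), ((3 : Fin 5), (4 : Fin 5)), ((4 : Fin 5), (0 : Fin 5)), ((4 : Fin 5), (1 : Fin 5))} : Finset (Fin 5 × Fin 5)), ∃ X ∈ D', (i X, j X) = t) →
      #D' ≤ #{U ∈ S.powerset | f U = top ∧ f (S \ U) = bot ∧ ∃ X ∈ D', X ⊆ U}) :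
    ∃ φ : D → Finset α, Function.Injective φ ∧
      ∀ X : D, (X : Finset α) ⊆ φ X ∧ φ X ⊆ S ∧ f (φ X) = top ∧ f (S \ φ X) = bot :=
  exists_injective_good_above_of_fullTypeCount S hf D i j hDS hDi hDj _ hT (by decide)
    open3_minus_arc_bipartiteAcyclic hcount

/-- **General reduction (any number of petals).**  For an opposite-free family `D` of antipodal bads, Hall (distinct good
representatives) follows as soon as the bare count `#D' ≤ #{goods above D'}` holds for every sub-family `D'` whose realised
type set admits NO bipartite-acyclic witness `(P, σ)`; sub-families with such a witness are settled by prim-hp-7's theorem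
`exists_injective_good_above_of_oppositeFree_bipartiteAcyclic`.  So Conjecture O_k is equivalent to the COUNT for families
realising a non-bipartite-acyclic type set (on five petals: exactly the full-type families of `open1/2/3`). -/
theorem exists_injective_good_above_of_nonBipartiteAcyclicCount (S : Finset α) {f : Finset α → Lab k}
    (hf : ∀ ⦃X Y : Finset α⦄, X ⊆ Y → f X ≤ f Y) (D : Finset (Finset α)) (i j : Finset α → Fin k)
    (hDS : ∀ X ∈ D, X ⊆ S) (hDi : ∀ X ∈ D, f X = petal (i X)) (hDj : ∀ X ∈ D, f (S \ X) = petal (j X))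
    (hOpp : ∀ X ∈ D, ∀ X' ∈ D, ¬ (i X = j X' ∧ j X = i X'))
    (hcount : ∀ D' ⊆ D, (¬ ∃ (P : Finset (Fin k)) (σ : Fin k → ℕ), ∀ X ∈ D',
        (i X ∈ P ∧ j X ∉ P) ∨ (i X ∉ P ∧ j X ∈ P) ∨ (i X ∉ P ∧ j X ∉ P ∧ σ (i X) < σ (j X))) →
      #D' ≤ #{U ∈ S.powerset | f U = top ∧ f (S \ U) = bot ∧ ∃ X ∈ D', X ⊆ U}) :
    ∃ φ : D → Finset α, Function.Injective φ ∧
      ∀ X : D, (X : Finset α) ⊆ φ X ∧ φ X ⊆ S ∧ f (φ X) = top ∧ f (S \ φ X) = bot := by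
  classical
  let t : D → Finset (Finset α) := fun X =>
    {U ∈ S.powerset | f U = top ∧ f (S \ U) = bot ∧ (X : Finset α) ⊆ U}
  have hHall : ∀ s : Finset D, #s ≤ #(s.biUnion t) := by
    intro s
    set D' : Finset (Finset α) := s.map (Function.Embedding.subtype _) with hD'
    have hD'sub : D' ⊆ D := by
      intro X hX
      obtain ⟨x, -, rfl⟩ := mem_map.mp hX
      exact x.2
    have hcard : #s = #D' := (card_map _).symm
    have hle : #D' ≤ #{U ∈ S.powerset | f U = top ∧ f (S \ U) = bot ∧ ∃ X ∈ D', X ⊆ U} := by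
      by_cases hw : ∃ (P : Finset (Fin k)) (σ : Fin k → ℕ), ∀ X ∈ D',
          (i X ∈ P ∧ j X ∉ P) ∨ (i X ∉ P ∧ j X ∈ P) ∨ (i X ∉ P ∧ j X ∉ P ∧ σ (i X) < σ (j X))
      · obtain ⟨P, σ, hT'⟩ := hw
        obtain ⟨φ, hφinj, hφ⟩ := exists_injective_good_above_of_oppositeFree_bipartiteAcyclic S hf D' i j
          (fun X hX => hDS X (hD'sub hX)) (fun X hX => hDi X (hD'sub hX)) (fun X hX => hDj X (hD'sub hX))
          P σ hT' (fun X hX X' hX' => hOpp X (hD'sub hX) X' (hD'sub hX'))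
        exact card_le_card_goods_above_of_sdr S f D' φ hφinj hφ
      · exact hcount D' hD'sub hw
    have hgoods : {U ∈ S.powerset | f U = top ∧ f (S \ U) = bot ∧ ∃ X ∈ D', X ⊆ U} ⊆ s.biUnion t := by
      intro U hU
      rw [mem_filter, mem_powerset] at hU
      obtain ⟨hUS, hUtop, hUbot, X, hX, hXU⟩ := hU
      obtain ⟨x, hx, rfl⟩ := mem_map.mp hX
      rw [mem_biUnion]
      refine ⟨x, hx, ?_⟩
      simp only [t, mem_filter, mem_powerset]
      exact ⟨hUS, hUtop, hUbot, hXU⟩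
    calc #s = #D' := hcard
      _ ≤ #{U ∈ S.powerset | f U = top ∧ f (S \ U) = bot ∧ ∃ X ∈ D', X ⊆ U} := hle
      _ ≤ #(s.biUnion t) := card_le_card hgoods
  obtain ⟨φ, hφinj, hφ⟩ := (all_card_le_biUnion_card_iff_exists_injective t).mp hHall
  refine ⟨φ, hφinj, fun X => ?_⟩
  have hX := hφ X
  simp only [t, mem_filter, mem_powerset] at hX
  exact ⟨hX.2.2.2, hX.1, hX.2.1, hX.2.2.1⟩

end OrientedAntipodalHall

end Summit.CriticalPhenomena.PercolationContinuityZ3.Theorems
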